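import Literature.NumberTheory.LFunctions.VinogradovKorobovBellotti
import Literature.NumberTheory.LFunctions.ZeroDensityNearOne
import Literature.NumberTheory.LFunctions.LogIntegral
import Mathlib.NumberTheory.Chebyshev
import HarnessLib

/-!
# RH-FREE — Bellotti 2026 (Bull. LMS): `N(σ,T) = O(1)` at the edge of the Korobov–Vinogradov region and Pintz's error term with `ε = 0` («nothing here bears on the truth of RH»)

Topic `Literature/NumberTheory/LFunctions` (RH literature-typing tranche 1, L4 "explicit zero
statistics": zero-density estimates near `σ = 1`, gen 10). Label: **RH-FREE** — unconditional
refereed material (Bull. Lond. Math. Soc. 58 (2026), no. 7; statements typed from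
arXiv:2508.02041v1, the publisher page not being reachable from the seat — `[cite: …]` locators are
those of the arXiv text). FIVE NAMED FACTS (`def … : Prop`, D-0014: nothing asserted, users take
`(h : …)`), definitions transcribing the source's quantities, and PROVED consequences. The source's
results are `≪`-statements (inexplicit constants; "Theorem 1.1, Theorem 1.3 and Corollary 1.4 can be
all made fully explicit" is announced, not carried out): they are typed with existential constants
and thresholds, never stronger than printed. Nothing here bears on the truth of RH; no endorsement.

Source: C. Bellotti, *A new zero-density estimate for `ζ(s)` and the error term in the prime number
theorem*, Bull. Lond. Math. Soc. 58 (2026), no. 7 = arXiv:2508.02041 `[corpus:paper:arxiv-2508.02041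
p0003 (Thms 1.1–1.3, Cor. 1.4), p0004 (Thm 1.5, Cor. 1.6), p0005–p0006 (§2: (1.1), Lemma 2.5),
p0011 (§5)]`.

## The objects (namespace `Bellotti2026`)

* `kvWidth A T = A/((log T)^{2/3}(log log T)^{1/3})` — the Korobov–Vinogradov width `ν` with
  constant `A` ((1.1): `ν(T) = A₀ (log T)^{−2/3}(log log T)^{−1/3}`).
* `IsKVZeroFreeConstant A₀` — **(1.1)**: "`A₀` is a Korobov–Vinogradov zero-free-region constant",
  i.e. for `|t|` sufficiently large `ζ(σ + it) ≠ 0` whenever `σ ≥ 1 − kvWidth A₀ |t|`. The tree's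
  `zero_free_region_bellotti_asymptotic` (Bellotti 2024, Thm 1.3, `A₀ = 1/48.0718`, "the current best
  known value") gives `IsKVZeroFreeConstant (1/48.0718)` (`isKVZeroFreeConstant_bellotti2024`), and
  the tree PROVES `∃ A₀ > 0, IsKVZeroFreeConstant A₀` (`exists_isKVZeroFreeConstant`, from its
  inexplicit Vinogradov–Korobov region `VKFromRichert.zeta_zeroFree_of_richertType`).
* `ExpSumHyp D` — the hypothesis of Theorem 1.3: `S(N,t) ≪ N^{1−1/(Dλ²)}` for `1 ≤ N ≤ t`,
  `λ = log t/log N`, `S(N,t) = max_{N<R≤2N} |Σ_{N≤n≤R} n^{−it}|` ((1.2)), written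
  `‖Σ_{n=N}^{R} n^{−it}‖ ≤ C₀ N^{1 − (log N)²/(D (log t)²)}` for all `N < R ≤ 2N` (the same input, up
  to the bookkeeping of a shift `u ∈ (0,1]`, as the tree's `ExpSumBound C D` of
  `RichertBoundsFromExpSum.lean`, an instance of which is the theorem `VKZeta.expSumBound_ivic`).
* `thm13Const D = 6(8D/3)^{1/3} + 12` — the exponent constant `c` of Theorem 1.3.
* `dKV A₀ = (5⁶A₀³/(2²·3⁴))^{1/5}` and `omegaKV A₀ x = dKV A₀ · (log x)^{3/5}(log log x)^{−1/5}` —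
  **(1.3)**: the value of Pintz's `ω(x) = min_{t≥1}{ν(t) log x + log t}` for the Korobov–Vinogradov
  `ν` (the source writes (1.3) as an identity and prints Cor. 1.6 in this closed form; Thm 1.5 is
  typed in the same closed form).

## Named facts

* `Bellotti2026_thm11` — **Theorem 1.1**: `T` large, `σ ≥ 1 − K(T)/((log T)^{2/3}(log log T)^{1/3})`,
  `α < 1`, `K(T) ≪ (log log T)^α` ⇒ `N(σ,T) ≪ exp(B(log log T)^α) K(T)` (`= o(log T)`), `B > 0`.
* `Bellotti2026_thm12` — **Theorem 1.2**: `A₀` a KV constant, `A > A₀` fixed, `T` large ⇒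
  `N(σ,T) = O(1)` for every `σ ≥ 1 − A(log T)^{−2/3}(log log T)^{−1/3}`.
* `Bellotti2026_thm13` — **Theorem 1.3**: under `S(N,t) ≪ N^{1−1/(Dλ²)}`, `N(σ,T) ≪ e^{cA}`,
  `c = 6(8D/3)^{1/3} + 12`, the implied constant independent of `A`.
* `Bellotti2026_thm15` — **Theorem 1.5**: `Δ(x) = |ψ(x) − x|/x ≪ e^{55A₀} e^{−ω(x)}` (Pintz's bound
  with `ε = 0`; Johnston's Question 1.1 of arXiv:2411.13791 for the KV region).
* `Bellotti2026_cor16` — **Corollary 1.6**: the same for `Δ₁ = |π(x) − li x|/(x/log x)` and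
  `Δ₂ = |ϑ(x) − x|/x`.

## Proved here

* `Bellotti2026.thm13Const_le_55` (`6(8·132.94357/3)^{1/3} + 12 ≤ 55`) and
  **`Bellotti2026_cor14_of_thm13`** — **Corollary 1.4** (`A > 1/48.0718`, `D = 132.94357` ⇒
  `N(σ,T) ≪ e^{55A}`) DERIVED from Theorem 1.3, the tree's fact `zero_free_region_bellotti_asymptotic`
  and the hypothesis `ExpSumHyp 132.94357` (the source's Lemma 2.5 = Bellotti 2024, Thm 1.5,
  `S(N,t) ≤ 8.7979 N^{1−1/(132.94357λ²)}`, kept as a hypothesis — not retyped here);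
* `Bellotti2026.le_dKV_bellotti2024` (`0.2125 ≤ dKV(1/48.0718)`), and
  **`Bellotti2026_thm15.psi_bound_02125`**: Thm 1.5 + `zero_free_region_bellotti_asymptotic` ⇒
  `|ψ(x) − x| ≤ C x exp(−0.2125 (log x)^{3/5}(log log x)^{−1/5})` for `x ≥ x₀` (compare the tree's
  explicit fact `JohnstonYang2023_thm14`, `0.1853` with Ford's region, and its inexplicit theorem
  `chebyshevPsi_vinogradovKorobov`);
* `Bellotti2026_thm15.theta` — the `ϑ`-clause of Corollary 1.6 FROM Theorem 1.5 (`|ψ − ϑ| ≤ 2√x log x`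
  is absorbed: `√x log x ≤ x e^{−d(log x)^{3/5}(log log x)^{−1/5}}` eventually,
  `Bellotti2026.eventually_sqrt_mul_log_le`);
* `Bellotti2026.IsKVZeroFreeConstant.mono`, `kvWidth_mono`, `Bellotti2026_thm12.of_isKVZeroFreeConstant_le`
  — monotonicity bookkeeping; `Bellotti2026_thm13.thm12` (Thm 1.3 ⇒ Thm 1.2 under `ExpSumHyp`);
  `Bellotti2026_thm12.bellotti2024` (the instance `A₀ = 1/48.0718`).

CONVENTIONS. The source counts `N(σ,T) = #{ρ : σ < β < 1, 0 < γ < T}` (open); the tree's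
`zetaZeroCountRe σ T` counts `β ≥ σ`, `0 < γ ≤ T` with multiplicity. Every typed bound is an
`O(1)`/`≪` bound "for all `σ ≥ 1 − A·ν₁(T)`, all `T ≥ T₁`, every fixed `A > A₀`" with EXISTENTIAL
constants and thresholds, for which the two `σ`/`T` conventions give equivalent statements (a closed
count for `(A, T)` is dominated by an open count for any `A' > A` at a slightly larger height, and
`A' > A₀` is again admissible). Multiplicity: the source does not say; typed WITH multiplicity (the
tree's count) — flagged for the reviewer; the multiplicity-free reading replaces `zetaZeroCountRe` by
`(zetaZeroBox σ T).ncard`.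

KERNEL STATUS (2026-08-27, theorem-only companion files): of the five named facts only
`Bellotti2026_thm11`, `Bellotti2026_thm13` and `Bellotti2026_thm15` are independent inputs —
**`Bellotti2026_thm12` follows from `Bellotti2026_thm11`** (`Bellotti2026_thm11.thm12`,
`ZetaZeroDensityVinogradovKorobovEdgeThm12.lean`: `α = 0`, `K ≡ A`) **and from `Bellotti2026_thm13`**
(`Bellotti2026_thm13.thm12_unconditional`, `ZetaZeroDensityVinogradovKorobovEdgeExpSum.lean`: the
exponential-sum hypothesis `ExpSumHyp D` holds for some `D`, `Bellotti2026.exists_expSumHyp`, by the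
tree's `VKZeta.expSumBound_ivic`), and **`Bellotti2026_cor16` follows from `Bellotti2026_thm15`**
(`Bellotti2026_thm15.cor16`, `PrimeNumberTheoremVinogradovKorobovTransfer.lean`: the same-exponent
`ϑ → π` transfer `VKTransfer.primeCounting_of_theta`).

NOT typed: Lemma 2.5 (= Bellotti 2024 Thm 1.5; enters only as the hypothesis `ExpSumHyp 132.94357`),
§§3–4 (the proofs), D. R. Johnston's general Theorem 2.1 of arXiv:2411.13791v2 (unrefereed; its
Cor. 2.3 `Δ ≪ e^{−ω(x)}(log x)⁹(log log x)^{−3}` is superseded by Thm 1.5).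

## References

* C. Bellotti, Bull. Lond. Math. Soc. 58 (2026), no. 7 (doi:10.1112/blms.70442) = arXiv:2508.02041v1,
  Thms 1.1–1.3, 1.5, Cors 1.4, 1.6, eqs. (1.1)–(1.4), Lemma 2.5. [Bellotti2026ZeroDensity]
* C. Bellotti, J. Math. Anal. Appl. 536 (2024) 128249, Thm 1.3 (`A₀ = 1/48.0718`), Thm 1.5
  (`D = 132.94357`). [Bellotti2024]
* J. Pintz, Acta Arith. 37 (1980) 209–220 (`Δ ≪ e^{−(1−ε)ω(x)}`). [Pintz1980]
* A. Ivić, *The Riemann Zeta-Function*, Wiley 1985, Thm 12.2 (the tree's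
  `chebyshevPsi_vinogradovKorobov`). [Ivic1985]
-/

noncomputable section

open Complex Real Filter Topology Asymptotics
open scoped Chebyshev

namespace Literature.NumberTheory.LFunctions

/-! ## The source's quantities -/

namespace Bellotti2026

/-- The Korobov–Vinogradov width with constant `A`: `ν_A(T) = A/((log T)^{2/3}(log log T)^{1/3})`
((1.1) with `A = A₀`; Theorems 1.2–1.3 with `A > A₀`). [cite: Bellotti2026ZeroDensity, §1 eq. (1.1)] -/
def kvWidth (A T : ℝ) : ℝ := A / (Real.log T ^ (2 / 3 : ℝ) * Real.log (Real.log T) ^ (1 / 3 : ℝ))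

/-- **(1.1): `A₀` is a Korobov–Vinogradov zero-free-region constant** — for `|t|` sufficiently large,
`ζ(σ + it) ≠ 0` whenever `σ ≥ 1 − A₀/((log|t|)^{2/3}(log log|t|)^{1/3})` ("the Korobov–Vinogradov
zero-free region constant in (1.1)"). [cite: Bellotti2026ZeroDensity, §1 eq. (1.1)] -/
def IsKVZeroFreeConstant (A₀ : ℝ) : Prop :=
  ∃ T₀ : ℝ, ∀ σ t : ℝ, T₀ ≤ |t| → 1 - kvWidth A₀ |t| ≤ σ → riemannZeta (σ + t * I) ≠ 0

/-- The hypothesis of Theorem 1.3 on the exponential sums (1.2)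
`S(N,t) = max_{N<R≤2N} |Σ_{N≤n≤R} n^{−it}|`: "for `1 ≤ N ≤ t`, `S(N,t) ≪ N^{1−1/(Dλ²)}`,
`λ = log t/log N`", i.e. `‖Σ_{n=N}^{R} n^{−it}‖ ≤ C₀ N^{1 − (log N)²/(D(log t)²)}` for all integers
`1 ≤ N < R ≤ 2N` and real `t ≥ N`. [cite: Bellotti2026ZeroDensity, §1 eq. (1.2) and Thm 1.3] -/
def ExpSumHyp (D : ℝ) : Prop :=
  ∃ C₀ : ℝ, ∀ (N R : ℕ) (t : ℝ), 1 ≤ N → N < R → R ≤ 2 * N → (N : ℝ) ≤ t →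
    ‖∑ n ∈ Finset.Icc N R, (n : ℂ) ^ (-(t * I))‖ ≤
      C₀ * (N : ℝ) ^ (1 - Real.log N ^ 2 / (D * Real.log t ^ 2))

/-- The exponent constant of Theorem 1.3: `c = 6(8D/3)^{1/3} + 12`.
[cite: Bellotti2026ZeroDensity, Thm 1.3] -/
def thm13Const (D : ℝ) : ℝ := 6 * (8 * D / 3) ^ (1 / 3 : ℝ) + 12

/-- **(1.3)**: `d = (5⁶A₀³/(2²·3⁴))^{1/5}`, the constant of Pintz's `ω(x)` for the Korobov–Vinogradov
region with constant `A₀`. [cite: Bellotti2026ZeroDensity, §1 eq. (1.3)] -/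
def dKV (A₀ : ℝ) : ℝ := (5 ^ 6 * A₀ ^ 3 / (2 ^ 2 * 3 ^ 4)) ^ (1 / 5 : ℝ)

/-- **(1.3)**: `ω(x) = d (log x)^{3/5}(log log x)^{−1/5}`, the value of
`min_{t ≥ 1}{ν(t) log x + log t}` for `ν(t) = A₀(log t)^{−2/3}(log log t)^{−1/3}`, as printed.
[cite: Bellotti2026ZeroDensity, §1 eqs. (1.2)–(1.3)] -/
def omegaKV (A₀ x : ℝ) : ℝ :=
  dKV A₀ * Real.log x ^ (3 / 5 : ℝ) * Real.log (Real.log x) ^ (-(1 / 5) : ℝ)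

/-- Unfolding lemma. [cite: Bellotti2026ZeroDensity, §1 eq. (1.1)] -/
theorem kvWidth_def (A T : ℝ) :
    kvWidth A T = A / (Real.log T ^ (2 / 3 : ℝ) * Real.log (Real.log T) ^ (1 / 3 : ℝ)) := rfl

/-- Unfolding lemma. [cite: Bellotti2026ZeroDensity, §1 eq. (1.3)] -/
theorem omegaKV_def (A₀ x : ℝ) :
    omegaKV A₀ x = dKV A₀ * Real.log x ^ (3 / 5 : ℝ) * Real.log (Real.log x) ^ (-(1 / 5) : ℝ) := rfl

/-- `log 3 > 1`. [folklore] -/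
private theorem one_lt_log_three : 1 < Real.log 3 := by
  rw [Real.lt_log_iff_exp_lt (by norm_num)]
  have := Real.exp_one_lt_d9; linarith

/-- For `T ≥ 3` the Korobov–Vinogradov denominator `(log T)^{2/3}(log log T)^{1/3}` of (1.1) is
positive. [cite: Bellotti2026ZeroDensity, §1 eq. (1.1)] -/
theorem kvDenom_pos {T : ℝ} (hT : 3 ≤ T) :
    0 < Real.log T ^ (2 / 3 : ℝ) * Real.log (Real.log T) ^ (1 / 3 : ℝ) := by
  have hL : 1 < Real.log T := one_lt_log_three.trans_le (Real.log_le_log (by norm_num) hT)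
  have hLL : 0 < Real.log (Real.log T) := Real.log_pos hL
  exact mul_pos (Real.rpow_pos_of_pos (by linarith) _) (Real.rpow_pos_of_pos hLL _)

/-- `A ↦ ν_A(T)` is non-decreasing for `T ≥ 3`. [cite: Bellotti2026ZeroDensity, §1 eq. (1.1)] -/
theorem kvWidth_mono {A A' T : ℝ} (hAA' : A ≤ A') (hT : 3 ≤ T) : kvWidth A T ≤ kvWidth A' T := by
  unfold kvWidth
  exact div_le_div_of_nonneg_right hAA' (kvDenom_pos hT).le

/-- `ν_A(T) > 0` for `A > 0`, `T ≥ 3`. [cite: Bellotti2026ZeroDensity, §1 eq. (1.1)] -/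
theorem kvWidth_pos {A T : ℝ} (hA : 0 < A) (hT : 3 ≤ T) : 0 < kvWidth A T :=
  div_pos hA (kvDenom_pos hT)

/-- `dKV A₀ ≥ 0`. [cite: Bellotti2026ZeroDensity, §1 eq. (1.3)] -/
theorem dKV_nonneg (A₀ : ℝ) (hA : 0 ≤ A₀) : 0 ≤ dKV A₀ := by
  unfold dKV; positivity

/-- A smaller constant is again a Korobov–Vinogradov zero-free-region constant (the region
`σ ≥ 1 − ν_{A₁}` is narrower for `A₁ ≤ A₀`). [cite: Bellotti2026ZeroDensity, §1 eq. (1.1)] -/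
theorem IsKVZeroFreeConstant.mono {A₀ A₁ : ℝ} (h : IsKVZeroFreeConstant A₀) (h10 : A₁ ≤ A₀) :
    IsKVZeroFreeConstant A₁ := by
  obtain ⟨T₀, hT₀⟩ := h
  refine ⟨max T₀ 3, fun σ t ht hσ ↦ hT₀ σ t ((le_max_left _ _).trans ht) ?_⟩
  have h3 : 3 ≤ |t| := (le_max_right _ _).trans ht
  have := kvWidth_mono h10 h3
  linarith

end Bellotti2026

open Bellotti2026

/-- **The tree's Bellotti 2024 Theorem 1.3 is (1.1) with `A₀ = 1/48.0718`** ("the current best known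
value for `A₀`"): `zero_free_region_bellotti_asymptotic → IsKVZeroFreeConstant (1/48.0718)`
(`1/(48.0718 · L^{2/3} · LL^{1/3}) = (1/48.0718)/(L^{2/3} LL^{1/3})`).
[cite: Bellotti2026ZeroDensity, §2.1 (after (1.1))] [cite: Bellotti2024, Thm 1.3] -/
theorem isKVZeroFreeConstant_bellotti2024 (h : zero_free_region_bellotti_asymptotic) :
    IsKVZeroFreeConstant (1 / 48.0718) := by
  obtain ⟨T₀, hT₀⟩ := h
  refine ⟨T₀, fun σ t ht hσ ↦ hT₀ σ t ht ?_⟩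
  have e : kvWidth (1 / 48.0718) |t| =
      1 / (48.0718 * Real.log |t| ^ (2 / 3 : ℝ) * Real.log (Real.log |t|) ^ (1 / 3 : ℝ)) := by
    rw [kvWidth, div_div, ← mul_assoc]
  rw [← e]; exact hσ

/-- **Non-vacuity, proved in the tree**: there IS a Korobov–Vinogradov zero-free-region constant
(`∃ A₀ > 0, IsKVZeroFreeConstant A₀`), from the tree's inexplicit Vinogradov–Korobov region
(`VKFromRichert.zeta_zeroFree_of_richertType` with the Richert-type bound
`exists_richertTypeBound_one`, Ivić Thm 6.1 road; standard axioms).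
[cite: Bellotti2026ZeroDensity, §1 eq. (1.1)] [cite: Ivic1985, Theorem 6.1] -/
theorem exists_isKVZeroFreeConstant : ∃ A₀ : ℝ, 0 < A₀ ∧ IsKVZeroFreeConstant A₀ := by
  obtain ⟨A, B, -, -, hR⟩ := exists_richertTypeBound_one
  obtain ⟨c, hc, hzf⟩ := VKFromRichert.zeta_zeroFree_of_richertType hR (by norm_num)
  refine ⟨c, hc, 21, fun σ t ht hσ ↦ hzf (σ + t * I) (by simpa using ht) ?_⟩
  have him : ((σ : ℂ) + t * I).im = t := by simp
  have hre : ((σ : ℂ) + t * I).re = σ := by simp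
  rw [him, hre]
  exact hσ

/-! ## Named facts -/

/-- NAMED FACT (**Bellotti 2026, Theorem 1.1**, as printed: "Consider `T` large and
`σ ≥ 1 − K(T)/((log T)^{2/3}(log log T)^{1/3})`, with `α < 1`, `K(T) ≪ (log log T)^α`. Then
`N(σ,T) ≪ exp(B(log log T)^α) K(T) = o(log T)`, where `B > 0` is an effective computable constant").
Typed with existential constants: for every `α < 1` and every majorant constant `C_K > 0` there are
`B, C > 0` such that for every function `K` with `0 < K(T) ≤ C_K (log log T)^α` for `T` large there is
`T₁` with `N(σ,T) ≤ C exp(B(log log T)^α) K(T)` for all `T ≥ T₁`, `σ ≥ 1 − K(T)/(…)` (`B, C` are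
allowed to depend on `α, C_K` — a reading no stronger than the printed one). `N(σ,T)` is the tree's
`zetaZeroCountRe` (module docstring, CONVENTIONS). Unconditional. Users take `(h : Bellotti2026_thm11)`.
[cite: Bellotti2026ZeroDensity, Thm 1.1] -/
def Bellotti2026_thm11 : Prop :=
  ∀ α : ℝ, α < 1 → ∀ C_K : ℝ, 0 < C_K →
    ∃ B C : ℝ, 0 < B ∧ 0 < C ∧
      ∀ K : ℝ → ℝ,
        (∃ T_K : ℝ, ∀ T : ℝ, T_K ≤ T → 0 < K T ∧ K T ≤ C_K * Real.log (Real.log T) ^ α) →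
          ∃ T₁ : ℝ, ∀ T : ℝ, T₁ ≤ T → ∀ σ : ℝ,
            1 - K T / (Real.log T ^ (2 / 3 : ℝ) * Real.log (Real.log T) ^ (1 / 3 : ℝ)) ≤ σ →
              (zetaZeroCountRe σ T : ℝ) ≤ C * Real.exp (B * Real.log (Real.log T) ^ α) * K T

/-- NAMED FACT (**Bellotti 2026, Theorem 1.2**, as printed: "Let `A₀` be the Korobov–Vinogradov
zero-free region constant in (1.1). Consider `A > A₀` a fixed positive constant and `T` large. Then,
for every `σ` satisfying `σ ≥ 1 − A(log T)^{−2/3}(log log T)^{−1/3}`, one has `N(σ,T) = O(1)`").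
Typed: for every `A₀ > 0` with `IsKVZeroFreeConstant A₀` and every `A > A₀` there are `C, T₁` with
`N(σ,T) ≤ C` for all `T ≥ T₁` and all `σ ≥ 1 − kvWidth A T`. Unconditional (the hypothesis (1.1) is
a theorem for some `A₀`, `exists_isKVZeroFreeConstant`, and the tree's fact
`zero_free_region_bellotti_asymptotic` for `A₀ = 1/48.0718`). Users take `(h : Bellotti2026_thm12)`.
[cite: Bellotti2026ZeroDensity, Thm 1.2] -/
def Bellotti2026_thm12 : Prop :=
  ∀ A₀ : ℝ, 0 < A₀ → IsKVZeroFreeConstant A₀ → ∀ A : ℝ, A₀ < A →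
    ∃ C T₁ : ℝ, ∀ T : ℝ, T₁ ≤ T → ∀ σ : ℝ, 1 - kvWidth A T ≤ σ → (zetaZeroCountRe σ T : ℝ) ≤ C

/-- NAMED FACT (**Bellotti 2026, Theorem 1.3**, as printed: "Consider `S(N,t)` defined in (1.2) and
assume that, for `1 ≤ N ≤ t`, `S(N,t) ≪ N^{1−1/(Dλ²)}`, where `D > 0` is a positive constant. Let
`A > A₀` be a fixed positive constant, where `A₀` is the Korobov–Vinogradov zero-free region constant
in (1.1). Then, for `T` large, and `σ ≥ 1 − A(log T)^{−2/3}(log log T)^{−1/3}`, the following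
estimate holds: `N(σ,T) ≪ e^{cA}`, `c = 6(8D/3)^{1/3} + 12`"). Typed with the implied constant `C`
INDEPENDENT of `A` (the content of the theorem beyond Thm 1.2, and the way §5 of the source uses it):
for `A₀ > 0` with (1.1) and `D > 0` with `ExpSumHyp D` there is `C` such that for every `A > A₀`
there is `T₁` with `N(σ,T) ≤ C e^{cA}` for all `T ≥ T₁`, `σ ≥ 1 − kvWidth A T`. Users take
`(h : Bellotti2026_thm13)`. [cite: Bellotti2026ZeroDensity, Thm 1.3] -/
def Bellotti2026_thm13 : Prop :=
  ∀ A₀ : ℝ, 0 < A₀ → IsKVZeroFreeConstant A₀ → ∀ D : ℝ, 0 < D → ExpSumHyp D →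
    ∃ C : ℝ, ∀ A : ℝ, A₀ < A → ∃ T₁ : ℝ, ∀ T : ℝ, T₁ ≤ T → ∀ σ : ℝ, 1 - kvWidth A T ≤ σ →
      (zetaZeroCountRe σ T : ℝ) ≤ C * Real.exp (thm13Const D * A)

/-- NAMED FACT (**Bellotti 2026, Theorem 1.5**, as printed: "Consider `Δ` defined in (1.4)
[`Δ(x) = |ψ(x) − x|/x`]. The following estimate holds: `Δ(x) ≪ exp(55A₀) exp(−ω(x))`, where `A₀`
is the Korobov–Vinogradov zero-free region constant in (1.1) and `ω(x)` is defined in (1.2)", with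
(1.3) `ω(x) = d (log x)^{3/5}(log log x)^{−1/5}`, `d = (5⁶A₀³/(2²·3⁴))^{1/5}`). Typed in the closed
form (1.3) (the form printed in Cor. 1.6), per admissible `A₀`, with an existential constant
absorbing `e^{55A₀}` and an existential threshold ("`x` large"): for every `A₀ > 0` with (1.1) there
are `C, x₀` with `|ψ(x) − x| ≤ C x exp(−omegaKV A₀ x)` for all `x ≥ x₀`. `ψ = Chebyshev.psi`.
Unconditional. Users take `(h : Bellotti2026_thm15)`. [cite: Bellotti2026ZeroDensity, Thm 1.5] -/
def Bellotti2026_thm15 : Prop :=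
  ∀ A₀ : ℝ, 0 < A₀ → IsKVZeroFreeConstant A₀ →
    ∃ C x₀ : ℝ, ∀ x : ℝ, x₀ ≤ x → |ψ x - x| ≤ C * x * Real.exp (-omegaKV A₀ x)

/-- NAMED FACT (**Bellotti 2026, Corollary 1.6**, as printed: "Given `Δ_{i=1,2}`, as in (1.5)
[`Δ₁(x) = |π(x) − li(x)|/(x/log x)`, `Δ₂(x) = |ϑ(x) − x|/x`], the following estimate holds:
`Δ_i ≪ exp(55A₀) exp(−d(log x)^{3/5}(log log x)^{−1/5})`, where `A₀` and `d` are the same as in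
Theorem 1.5"). Typed per admissible `A₀` with existential constants and threshold;
`π(x) = Nat.primeCounting ⌊x⌋₊`, `li = logIntegral` (the principal-value `li`; the offset `Li`
differs by a constant, immaterial here), `ϑ = Chebyshev.theta`. Unconditional. Users take
`(h : Bellotti2026_cor16)`; the `ϑ`-clause follows from Thm 1.5 (`Bellotti2026_thm15.theta`).
[cite: Bellotti2026ZeroDensity, Cor. 1.6] -/
def Bellotti2026_cor16 : Prop :=
  ∀ A₀ : ℝ, 0 < A₀ → IsKVZeroFreeConstant A₀ →
    ∃ C x₀ : ℝ, ∀ x : ℝ, x₀ ≤ x →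
      |(Nat.primeCounting ⌊x⌋₊ : ℝ) - logIntegral x| ≤ C * (x / Real.log x) * Real.exp (-omegaKV A₀ x) ∧
        |θ x - x| ≤ C * x * Real.exp (-omegaKV A₀ x)

/-! ## Corollary 1.4 from Theorem 1.3 -/

/-- `(8 · 132.94357/3)^{1/3} ≤ 43/6`, hence `c(132.94357) = 6(8D/3)^{1/3} + 12 ≤ 55`
(`8D/3 = 354.516… ≤ (43/6)³ = 368.08…`). [cite: Bellotti2026ZeroDensity, Cor. 1.4] -/
theorem Bellotti2026.thm13Const_le_55 : thm13Const 132.94357 ≤ 55 := by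
  unfold thm13Const
  have h1 : (8 * (132.94357 : ℝ) / 3) ^ (1 / 3 : ℝ) ≤ ((43 / 6 : ℝ) ^ (3 : ℕ)) ^ (1 / 3 : ℝ) :=
    Real.rpow_le_rpow (by norm_num) (by norm_num) (by norm_num)
  have h2 : ((43 / 6 : ℝ) ^ (3 : ℕ)) ^ (1 / 3 : ℝ) = 43 / 6 := by
    rw [← Real.rpow_natCast, ← Real.rpow_mul (by norm_num)]; norm_num
  rw [h2] at h1
  linarith

/-- Monotonicity of the Theorem-1.3 bound in its constant: `c(D) ≥ 12 > 0`, so `e^{c(D)A} ≤ e^{55A}`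
for `A ≥ 0` once `c(D) ≤ 55`. [cite: Bellotti2026ZeroDensity, Thm 1.3 and Cor. 1.4] -/
theorem Bellotti2026.exp_thm13Const_le {A : ℝ} (hA : 0 ≤ A) :
    Real.exp (thm13Const 132.94357 * A) ≤ Real.exp (55 * A) :=
  Real.exp_le_exp.2 (mul_le_mul_of_nonneg_right thm13Const_le_55 hA)

/-- **Bellotti 2026, Corollary 1.4, from Theorem 1.3** (as printed: "Consider `A > 1/48.0718` a fixed
positive constant and `T` large. The following estimate holds for every
`σ ≥ 1 − A(log T)^{−2/3}(log log T)^{−1/3}`: `N(σ,T) ≪ e^{55A}`"; the source: "inserting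
`A₀ = 1/48.0718` and `D = 132.94357` [Bellotti 2024, Thms 1.3 and 1.5] into Theorem 1.3"). PROVED
modulo the named facts `Bellotti2026_thm13`, `zero_free_region_bellotti_asymptotic` (the tree's
Bellotti 2024 Thm 1.3) and the exponential-sum hypothesis `ExpSumHyp 132.94357` (Lemma 2.5 =
Bellotti 2024 Thm 1.5): there is `C` such that for every `A > 1/48.0718` there is `T₁` with
`N(σ,T) ≤ C e^{55A}` for `T ≥ T₁`, `σ ≥ 1 − kvWidth A T`.
[cite: Bellotti2026ZeroDensity, Cor. 1.4] [cite: Bellotti2024, Thms 1.3 and 1.5] -/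
theorem Bellotti2026_cor14_of_thm13 (h13 : Bellotti2026_thm13)
    (hZ : zero_free_region_bellotti_asymptotic) (hS : ExpSumHyp 132.94357) :
    ∃ C : ℝ, ∀ A : ℝ, 1 / 48.0718 < A → ∃ T₁ : ℝ, ∀ T : ℝ, T₁ ≤ T → ∀ σ : ℝ,
      1 - kvWidth A T ≤ σ → (zetaZeroCountRe σ T : ℝ) ≤ C * Real.exp (55 * A) := by
  obtain ⟨C, hC⟩ := h13 (1 / 48.0718) (by norm_num) (isKVZeroFreeConstant_bellotti2024 hZ)
    132.94357 (by norm_num) hS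
  refine ⟨max C 0, fun A hA ↦ ?_⟩
  obtain ⟨T₁, hT₁⟩ := hC A hA
  refine ⟨T₁, fun T hT σ hσ ↦ ((hT₁ T hT σ hσ).trans ?_)⟩
  have hA0 : 0 ≤ A := by linarith
  calc C * Real.exp (thm13Const 132.94357 * A)
      ≤ max C 0 * Real.exp (thm13Const 132.94357 * A) :=
        mul_le_mul_of_nonneg_right (le_max_left _ _) (Real.exp_pos _).le
    _ ≤ max C 0 * Real.exp (55 * A) :=
        mul_le_mul_of_nonneg_left (exp_thm13Const_le hA0) (le_max_right _ _)

/-! ## Theorem 1.3 ⇒ Theorem 1.2; monotone readings -/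

namespace Bellotti2026_thm13

/-- Theorem 1.3 implies Theorem 1.2 under the exponential-sum hypothesis for SOME `D > 0`
(e.g. Lemma 2.5's `D = 132.94357`; the tree proves an inexplicit instance of the shifted form,
`VKZeta.expSumBound_ivic`). [cite: Bellotti2026ZeroDensity, Thms 1.2–1.3] -/
theorem thm12 (h13 : Bellotti2026_thm13) {D : ℝ} (hD : 0 < D) (hS : ExpSumHyp D) :
    Bellotti2026_thm12 := by
  intro A₀ hA₀ hKV A hA
  obtain ⟨C, hC⟩ := h13 A₀ hA₀ hKV D hD hS
  obtain ⟨T₁, hT₁⟩ := hC A hA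
  exact ⟨C * Real.exp (thm13Const D * A), T₁, hT₁⟩

end Bellotti2026_thm13

namespace Bellotti2026_thm12

/-- Theorem 1.2 read at a narrower region: if `N(σ,T) ≤ C` for `σ ≥ 1 − ν_A`, then also for
`σ ≥ 1 − ν_{A'}` with `A₀ < A' ≤ A` (same `C`, heights `≥ 3`).
[cite: Bellotti2026ZeroDensity, Thm 1.2] -/
theorem of_isKVZeroFreeConstant_le (h : Bellotti2026_thm12) {A₀ A A' : ℝ} (hA₀ : 0 < A₀)
    (hKV : IsKVZeroFreeConstant A₀) (hA' : A₀ < A') (hA'A : A' ≤ A) :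
    ∃ C T₁ : ℝ, ∀ T : ℝ, T₁ ≤ T → ∀ σ : ℝ, 1 - kvWidth A' T ≤ σ →
      (zetaZeroCountRe σ T : ℝ) ≤ C := by
  obtain ⟨C, T₁, hT₁⟩ := h A₀ hA₀ hKV A (hA'.trans_le hA'A)
  refine ⟨C, max T₁ 3, fun T hT σ hσ ↦ hT₁ T ((le_max_left _ _).trans hT) σ ?_⟩
  have := kvWidth_mono hA'A ((le_max_right _ _).trans hT)
  linarith

/-- **The instance `A₀ = 1/48.0718`** (Bellotti 2024, Thm 1.3, the tree's
`zero_free_region_bellotti_asymptotic`): for every `A > 1/48.0718`, `N(σ,T) = O(1)` on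
`σ ≥ 1 − A(log T)^{−2/3}(log log T)^{−1/3}`, `T` large.
[cite: Bellotti2026ZeroDensity, Thm 1.2 and §2.1] [cite: Bellotti2024, Thm 1.3] -/
theorem bellotti2024 (h : Bellotti2026_thm12) (hZ : zero_free_region_bellotti_asymptotic) {A : ℝ}
    (hA : 1 / 48.0718 < A) :
    ∃ C T₁ : ℝ, ∀ T : ℝ, T₁ ≤ T → ∀ σ : ℝ, 1 - kvWidth A T ≤ σ → (zetaZeroCountRe σ T : ℝ) ≤ C :=
  h (1 / 48.0718) (by norm_num) (isKVZeroFreeConstant_bellotti2024 hZ) A hA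

/-- **Unconditional non-vacuous instance**: with the tree's proved Korobov–Vinogradov constant
(`exists_isKVZeroFreeConstant`), Theorem 1.2 yields SOME `A > 0` with `N(σ,T) = O(1)` on
`σ ≥ 1 − A(log T)^{−2/3}(log log T)^{−1/3}`. [cite: Bellotti2026ZeroDensity, Thm 1.2] -/
theorem exists_pos (h : Bellotti2026_thm12) :
    ∃ A : ℝ, 0 < A ∧ ∃ C T₁ : ℝ, ∀ T : ℝ, T₁ ≤ T → ∀ σ : ℝ, 1 - kvWidth A T ≤ σ →
      (zetaZeroCountRe σ T : ℝ) ≤ C := by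
  obtain ⟨A₀, hA₀, hKV⟩ := exists_isKVZeroFreeConstant
  exact ⟨2 * A₀, by linarith, h A₀ hA₀ hKV (2 * A₀) (by linarith)⟩

end Bellotti2026_thm12

/-! ## Theorem 1.5 with `A₀ = 1/48.0718`: the constant `d ≥ 0.2125` -/

/-- `0.2125 ≤ d(1/48.0718) = (5⁶/(2²·3⁴·48.0718³))^{1/5}` (`0.2125⁵ = 4.333…·10⁻⁴ ≤ 4.341…·10⁻⁴`).
[cite: Bellotti2026ZeroDensity, §1 eq. (1.3)] -/
theorem Bellotti2026.le_dKV_bellotti2024 : (0.2125 : ℝ) ≤ dKV (1 / 48.0718) := by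
  unfold dKV
  have hq : (0.2125 : ℝ) ^ (5 : ℕ) ≤ 5 ^ 6 * (1 / 48.0718 : ℝ) ^ 3 / (2 ^ 2 * 3 ^ 4) := by norm_num
  have h1 : ((0.2125 : ℝ) ^ (5 : ℕ)) ^ (1 / 5 : ℝ) ≤
      (5 ^ 6 * (1 / 48.0718 : ℝ) ^ 3 / (2 ^ 2 * 3 ^ 4)) ^ (1 / 5 : ℝ) :=
    Real.rpow_le_rpow (by positivity) hq (by norm_num)
  have h2 : ((0.2125 : ℝ) ^ (5 : ℕ)) ^ (1 / 5 : ℝ) = 0.2125 := by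
    rw [← Real.rpow_natCast, ← Real.rpow_mul (by norm_num)]; norm_num
  rwa [h2] at h1

namespace Bellotti2026_thm15

/-- Monotone reading in the exponent constant: for `x ≥ 16 > e^e` one has `log log x > 1 > 0`, so
`exp(−omegaKV A₀ x) ≤ exp(−d' (log x)^{3/5}(log log x)^{−1/5})` for any `d' ≤ dKV A₀`.
[cite: Bellotti2026ZeroDensity, §1 eq. (1.3)] -/
theorem exp_neg_omegaKV_le {A₀ d' x : ℝ} (hd : d' ≤ dKV A₀) (hx : 16 ≤ x) :
    Real.exp (-omegaKV A₀ x) ≤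
      Real.exp (-(d' * Real.log x ^ (3 / 5 : ℝ) * Real.log (Real.log x) ^ (-(1 / 5) : ℝ))) := by
  have hx0 : 0 < x := by linarith
  have hL : 0 ≤ Real.log x := Real.log_nonneg (by linarith)
  have hP : 0 ≤ Real.log x ^ (3 / 5 : ℝ) * Real.log (Real.log x) ^ (-(1 / 5) : ℝ) :=
    mul_nonneg (Real.rpow_nonneg hL _) (Real.rpow_nonneg (Real.log_nonneg (by
      rw [Real.le_log_iff_exp_le hx0]; have := Real.exp_one_lt_d9; linarith)) _)
  rw [omegaKV, Real.exp_le_exp, neg_le_neg_iff, mul_assoc, mul_assoc]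
  exact mul_le_mul_of_nonneg_right hd hP

/-- **Thm 1.5 at `A₀ = 1/48.0718` (Bellotti 2024): `|ψ(x) − x| ≤ C x exp(−0.2125 (log x)^{3/5}(log log x)^{−1/5})`
for `x ≥ x₀`** (PROVED modulo `Bellotti2026_thm15` and `zero_free_region_bellotti_asymptotic`; the
source's `d(1/48.0718) = 0.21257…`). Compare the tree's explicit fact `JohnstonYang2023_thm14`
(`0.1853`, Ford's region, all `x ≥ 23`) and its inexplicit theorem `chebyshevPsi_vinogradovKorobov`.
[cite: Bellotti2026ZeroDensity, Thm 1.5 and eq. (1.3)] [cite: Bellotti2024, Thm 1.3] -/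
theorem psi_bound_02125 (h : Bellotti2026_thm15) (hZ : zero_free_region_bellotti_asymptotic) :
    ∃ C x₀ : ℝ, ∀ x : ℝ, x₀ ≤ x → |ψ x - x| ≤ C * x *
      Real.exp (-(0.2125 * Real.log x ^ (3 / 5 : ℝ) * Real.log (Real.log x) ^ (-(1 / 5) : ℝ))) := by
  obtain ⟨C, x₀, hx₀⟩ := h (1 / 48.0718) (by norm_num) (isKVZeroFreeConstant_bellotti2024 hZ)
  refine ⟨max C 0, max x₀ 16, fun x hx ↦ ?_⟩
  have hx16 : 16 ≤ x := (le_max_right _ _).trans hx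
  have hx0 : 0 ≤ x := by linarith
  have h1 := hx₀ x ((le_max_left _ _).trans hx)
  calc |ψ x - x| ≤ C * x * Real.exp (-omegaKV (1 / 48.0718) x) := h1
    _ ≤ max C 0 * x * Real.exp (-omegaKV (1 / 48.0718) x) := by
        gcongr
        · exact le_max_left _ _
    _ ≤ max C 0 * x * Real.exp (-(0.2125 * Real.log x ^ (3 / 5 : ℝ) *
          Real.log (Real.log x) ^ (-(1 / 5) : ℝ))) :=
        mul_le_mul_of_nonneg_left (exp_neg_omegaKV_le le_dKV_bellotti2024 hx16)
          (mul_nonneg (le_max_right _ _) hx0)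

end Bellotti2026_thm15

/-! ## The `ϑ`-clause of Corollary 1.6 from Theorem 1.5 -/

/-- **`√x log x` is absorbed by the Korobov–Vinogradov main term**: for every `d ≥ 0`, eventually
`√x log x ≤ x exp(−d (log x)^{3/5}(log log x)^{−1/5})` (indeed `log u + d u^{3/5} ≤ u/2` for large
`u = log x`, and `(log log x)^{−1/5} ≤ 1` for `x ≥ e^e`) — the step behind "Theorem 1.5 has an immediate
corollary" for `ϑ` (Ivić's passage (12.26) → (12.27)).
[cite: Bellotti2026ZeroDensity, Cor. 1.6] [cite: Ivic1985, Theorem 12.2 eq. (12.26)–(12.27)] -/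
theorem Bellotti2026.eventually_sqrt_mul_log_le {d : ℝ} (hd : 0 ≤ d) :
    ∀ᶠ x : ℝ in atTop, Real.sqrt x * Real.log x ≤
      x * Real.exp (-(d * Real.log x ^ (3 / 5 : ℝ) * Real.log (Real.log x) ^ (-(1 / 5) : ℝ))) := by
  -- `log u ≤ u/4` and `d u^{3/5} ≤ u/4` eventually in `u`
  have h5a : ∀ᶠ u : ℝ in atTop, Real.log u ≤ u / 4 := by
    have hb := Real.isLittleO_log_id_atTop.bound (show (0 : ℝ) < 1 / 4 by norm_num)
    filter_upwards [hb, eventually_ge_atTop 0] with u hu hu0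
    rw [Real.norm_eq_abs, Real.norm_eq_abs, id, abs_of_nonneg hu0] at hu
    linarith [le_abs_self (Real.log u)]
  have h5b : ∀ᶠ u : ℝ in atTop, d * u ^ (3 / 5 : ℝ) ≤ u / 4 := by
    filter_upwards [eventually_ge_atTop (max 1 ((4 * d) ^ (5 / 2 : ℝ)))] with u hu
    have hu1 : 1 ≤ u := (le_max_left _ _).trans hu
    have hu0 : 0 < u := by linarith
    have h4d : 4 * d ≤ u ^ (2 / 5 : ℝ) := by
      have h := Real.rpow_le_rpow (by positivity) ((le_max_right _ _).trans hu)
        (show (0 : ℝ) ≤ 2 / 5 by norm_num)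
      rwa [← Real.rpow_mul (by positivity), show (5 / 2 : ℝ) * (2 / 5) = 1 by norm_num,
        Real.rpow_one] at h
    have hsplit : u ^ (2 / 5 : ℝ) * u ^ (3 / 5 : ℝ) = u := by
      rw [← Real.rpow_add hu0]; norm_num
    have h35 : 0 ≤ u ^ (3 / 5 : ℝ) := Real.rpow_nonneg hu0.le _
    nlinarith [mul_le_mul_of_nonneg_right h4d h35]
  have h5 : ∀ᶠ u : ℝ in atTop, Real.log u + d * u ^ (3 / 5 : ℝ) ≤ u / 2 := by
    filter_upwards [h5a, h5b] with u ha hb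
    linarith
  -- pull back along `u = log x`
  have h6 := Real.tendsto_log_atTop.eventually h5
  filter_upwards [h6, eventually_ge_atTop (Real.exp (Real.exp 1))] with x hx hxe
  have hx0 : 0 < x := (Real.exp_pos _).trans_le hxe
  have hL : Real.exp 1 ≤ Real.log x := by
    rw [Real.le_log_iff_exp_le hx0]; exact hxe
  have hL0 : 0 < Real.log x := (Real.exp_pos 1).trans_le hL
  have hLL : 1 ≤ Real.log (Real.log x) := by
    rw [Real.le_log_iff_exp_le hL0]; exact hL
  -- `(log log x)^{-1/5} ≤ 1`
  have hLLpow : Real.log (Real.log x) ^ (-(1 / 5) : ℝ) ≤ 1 :=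
    Real.rpow_le_one_of_one_le_of_nonpos hLL (by norm_num)
  have hP : d * Real.log x ^ (3 / 5 : ℝ) * Real.log (Real.log x) ^ (-(1 / 5) : ℝ) ≤
      d * Real.log x ^ (3 / 5 : ℝ) := by
    have h0 : 0 ≤ d * Real.log x ^ (3 / 5 : ℝ) := mul_nonneg hd (Real.rpow_nonneg hL0.le _)
    simpa using mul_le_mul_of_nonneg_left hLLpow h0
  -- `√x log x = exp(u/2 + log u) ≤ exp(u − d u^{3/5}) ≤ x e^{−d L(x)}`
  have e1 : Real.sqrt x * Real.log x = Real.exp (Real.log x / 2 + Real.log (Real.log x)) := by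
    rw [Real.exp_add, Real.exp_log hL0, Real.sqrt_eq_rpow, Real.rpow_def_of_pos hx0]
    ring_nf
  have e2 : x * Real.exp (-(d * Real.log x ^ (3 / 5 : ℝ) * Real.log (Real.log x) ^ (-(1 / 5) : ℝ))) =
      Real.exp (Real.log x - d * Real.log x ^ (3 / 5 : ℝ) * Real.log (Real.log x) ^ (-(1 / 5) : ℝ)) := by
    rw [sub_eq_add_neg, Real.exp_add, Real.exp_log hx0]
  rw [e1, e2, Real.exp_le_exp]
  linarith

namespace Bellotti2026_thm15

/-- **The `ϑ`-clause of Corollary 1.6 from Theorem 1.5** (PROVED): for every admissible `A₀ > 0` there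
are `C, x₀` with `|ϑ(x) − x| ≤ C x exp(−ω(x))` for `x ≥ x₀`, via Mathlib's `|ψ(x) − ϑ(x)| ≤ 2√x log x`
(`Chebyshev.abs_psi_sub_theta_le_sqrt_mul_log`) and `Bellotti2026.eventually_sqrt_mul_log_le`.
[cite: Bellotti2026ZeroDensity, Cor. 1.6] -/
theorem theta (h : Bellotti2026_thm15) {A₀ : ℝ} (hA₀ : 0 < A₀) (hKV : IsKVZeroFreeConstant A₀) :
    ∃ C x₀ : ℝ, ∀ x : ℝ, x₀ ≤ x → |θ x - x| ≤ C * x * Real.exp (-omegaKV A₀ x) := by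
  obtain ⟨C, x₀, hx₀⟩ := h A₀ hA₀ hKV
  obtain ⟨x₁, hx₁⟩ := (eventually_sqrt_mul_log_le (dKV_nonneg A₀ hA₀.le)).exists_forall_of_atTop
  refine ⟨C + 2, max (max x₀ x₁) 1, fun x hx ↦ ?_⟩
  have hxx₀ : x₀ ≤ x := (le_max_left _ _).trans ((le_max_left _ _).trans hx)
  have hxx₁ : x₁ ≤ x := (le_max_right _ _).trans ((le_max_left _ _).trans hx)
  have hx1 : 1 ≤ x := (le_max_right _ _).trans hx
  have h1 := hx₀ x hxx₀
  have h2 := Chebyshev.abs_psi_sub_theta_le_sqrt_mul_log hx1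
  have h3 : Real.sqrt x * Real.log x ≤ x * Real.exp (-omegaKV A₀ x) := by
    have := hx₁ x hxx₁
    rwa [omegaKV, mul_assoc (dKV A₀)] at *
  have htri : |θ x - x| ≤ |ψ x - x| + |ψ x - θ x| := by
    have := abs_sub_le (θ x) (ψ x) x
    rwa [abs_sub_comm (θ x) (ψ x), add_comm] at this
  calc |θ x - x| ≤ |ψ x - x| + |ψ x - θ x| := htri
    _ ≤ C * x * Real.exp (-omegaKV A₀ x) + 2 * (x * Real.exp (-omegaKV A₀ x)) := by
        refine add_le_add h1 (h2.trans ?_); linarith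
    _ = (C + 2) * x * Real.exp (-omegaKV A₀ x) := by ring

end Bellotti2026_thm15

end Literature.NumberTheory.LFunctions

end
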